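import Literature.Probability.RandomPlanarGeometry.HexSAWBrickWallStripFugacityTwoSidedProp6
import Literature.Probability.RandomPlanarGeometry.HexSAWBrickWallPolygonGlue
import Literature.Probability.RandomPlanarGeometry.SAWPatternTheorem
import Mathlib.Analysis.Complex.ExponentialBounds
import HarnessLib

/-!
# One attractive wall, any width, any second fugacity: excursion walks and the lower window `y + 3/(10y) ≤ μ_T(y,z)²`
# (`T ≥ 1`, `z ≥ 1`, `y ≥ 4`) — the strip rates of honeycomb SAW at high fugacity are AT LEAST `Θ(1/y)` above the zig-zag value `y`

Topic `Literature/Probability/RandomPlanarGeometry` (lane «pcv-sawmu», car «EXCURSION LOWER WINDOW», a-p5 gen 15; the construction twin of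
`HexSAWBrickWallStripFugacityWidthOneSwitch.lean` (switch walks — there the second unit is the 3-step switch to the other wall, here it is
the 6-step forward excursion); continues `HexSAWBrickWallStripFugacityTwoSided.lean` (`HexBW.stripZ₂`, `stripMuY₂`, `tendsto_stripZ₂_rpow`,
`stripMuY₂_one_right : μ_T(y,1) = stripMuY₀ T y`), `HexSAWBrickWallStripFugacityLevel0.lean` (`stripMuY₀_mono`: Prop. 7's monotonicity in `T`)
and `HexSAWBrickWallStripFugacityTwoSidedProp6.lean` (`stripMuY₂_mono_right`: Prop. 6's monotonicity in `z`)).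

Source frame: N. R. Beaton, M. Bousquet-Mélou, J. de Gier, H. Duminil-Copin, A. J. Guttmann, CMP 326 (2014) = arXiv:1109.0358v5, §3.2 p. 10
(`S_T`, `C_{T,k}(y,z)`, Proposition 6), Proposition 7 (p. 11: `μ_T(1,y) < μ_{T+1}(1,y)`; only its non-strict half, the tree's `stripMuY₀_mono`, is used), §3.1 Proposition 5 (p. 9 l. 16: the zig-zag
bound `√y`). I. G. Enting, I. Jensen, LNP 775 (2009), §7.4.2, Fig. 7.10 (brick-wall form). N. Madras, G. Slade, *The Self-Avoiding Walk*
(1993), §1.2 (concatenation), §8.2 (8.2.1)–(8.2.3) (strips).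

## What is proved (namespace `Literature.Probability.RandomPlanarGeometry.SAW.HexBW`)

* the units `vUnit false` = two steps along the wall, `vUnit true` = the forward excursion `(0,0)(1,0)(1,1)(2,1)(3,1)(3,0)(4,0)` (6 steps, shift 4,
  exactly one new bottom wall vertex — `sum_vUnit_bot`); excursion words `exWalk`, `exLen_eq : |ω| = 2n + 4·#s`, `exWalk_mem_saws`, `isBW_exWalk`,
  `exPair_mem_stripPairs : exPair n s ∈ stripPairs 1 (2n + 4#s)`, `bottomVisits₀_exWalk : bc = n + 1`, `exWalk_decode` / `exPair_injOn`;
* **`choose_mul_pow_le_stripZ₂_one_one`** — `C(n,k)·y^{n+1} ≤ C_{1,2n+4k}(y,1)` (`y ≥ 0`); `mul_pow_pow_le_stripZ₂_one_one`;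
  **`rpow_le_stripMuY₂_one_one`** — `(m·y^m)^{1/(2m+4)} ≤ μ_1(y,1)` (`y ≥ 1`); `mul_pow_le_stripMuY₂_one_one_pow` — `m·y^m ≤ μ_1(y,1)^{2m+4}`;
* ★ **`add_div_le_stripMuY₂_one_one_sq`** — `4 ≤ y → y + 3/(10y) ≤ μ_1(y,1)²` (`m = ⌊3y²⌋+1`, `(1+x)^n ≤ e^{nx}`, `e < 3`);
* ★★ **`add_div_le_stripMuY₂_sq`** — `1 ≤ T → 4 ≤ y → 1 ≤ z → y + 3/(10y) ≤ μ_T(y,z)²`; **`add_div_le_stripMuY₀_sq`** — the one-wall rates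
  `μ_T(y,1)² ≥ y + 3/(10y)` for every `T ≥ 1`, `y ≥ 4`.

With the windows of `HexSAWBrickWallStripFugacityTwoWallOrder.lean` (`μ_T(y,y)² ≤ y + 6/y`, `T ≥ 3`, `y ≥ 25`) and
`HexSAWBrickWallStripFugacityWidthOneWindow.lean` (`μ_T(y,1)² ≤ y + 6/y`): for every `T ≥ 3` and `y ≥ 25`, `μ_T(y,y)² − y` and `μ_T(y,1)² − y`
lie in `[3/(10y), 6/y]` — the correction to the zig-zag value is of order EXACTLY `1/y`, uniformly in the width.  Label (author's proposal):
LANE LEMMA S (construction) / NEW-IN-WRITING (modest); print has the zig-zag lower bound `√y` only (BBdGDCG14 Cor. 8's proof).  Constant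
`3/10` not claimed sharp (the construction's rate solves `y t² + y t⁶ = 1`, i.e. `≈ y + 1/y`; the entropy bound `C(jm,j) ≥ m^j` costs the factor).
-/

noncomputable section

open Finset Filter Topology Literature.Probability.LatticeModels Literature.Probability.Percolation SimpleGraph

namespace Literature.Probability.RandomPlanarGeometry.SAW.HexBW

-- Membership in `Zd.saws 2 n` / `saws n` is only ever used through `Zd.mem_saws` (never unfolded: for a numeral `n` the
-- definitional unfolding evaluates the finset).
attribute [local irreducible] Zd.saws saws

variable {y : ℝ}

/-- Two-coordinate extensionality for sites of `ℤ²` (local twin). [cite: MadrasSlade1993, §1.1] -/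
private theorem site_ext₂ {x z : Site 2} (h0 : x 0 = z 0) (h1 : x 1 = z 1) : x = z :=
  funext fun i => by fin_cases i <;> assumption

/-! ### §1 The two units: the plain step-pair `P` and the forward excursion `X` -/

/-- Abscissa offset at time `i`: plain `0,1,2,2,…`; excursion `0,1,1,2,3,3,4,4,…`. [cite: EntingJensen2009, §7.4.2, Fig. 7.10] -/
def vX : Bool → ℕ → ℤ
  | false, i => if i = 0 then 0 else if i = 1 then 1 else 2
  | true, i => if i = 0 then 0 else if i ≤ 2 then 1 else if i = 3 then 2 else if i ≤ 5 then 3 else 4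

/-- Ordinate offset at time `i`: plain `0`; excursion `0,0,1,1,1,0,0,…` (a dip to the next row for three sites).
[cite: EntingJensen2009, §7.4.2, Fig. 7.10] -/
def vY : Bool → ℕ → ℤ
  | false, _ => 0
  | true, i => if i ≤ 1 then 0 else if i ≤ 4 then 1 else 0

/-- Length of a unit: plain `2`, excursion `6`. [cite: EntingJensen2009, §7.4.2, Fig. 7.10] -/
def vLen : Bool → ℕ
  | false => 2
  | true => 6

/-- Horizontal shift of a unit: plain `2`, excursion `4`. [cite: EntingJensen2009, §7.4.2, Fig. 7.10] -/
def vShift : Bool → ℤ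
  | false => 2
  | true => 4

/-- The unit walk from the origin (frozen after its length). [cite: EntingJensen2009, §7.4.2, Fig. 7.10] -/
def vUnit (b : Bool) (i : ℕ) : Site 2 := ![vX b i, vY b i]

/-- Abscissa of the unit walk. [cite: EntingJensen2009, §7.4.2, Fig. 7.10] -/
@[simp] theorem vUnit_apply_zero (b : Bool) (i : ℕ) : vUnit b i 0 = vX b i := rfl

/-- Ordinate of the unit walk. [cite: EntingJensen2009, §7.4.2, Fig. 7.10] -/
@[simp] theorem vUnit_apply_one (b : Bool) (i : ℕ) : vUnit b i 1 = vY b i := rfl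

/-- The unit starts at the origin. [cite: EntingJensen2009, §7.4.2, Fig. 7.10] -/
theorem vUnit_zero (b : Bool) : vUnit b 0 = 0 :=
  site_ext₂ (by cases b <;> simp [vX]) (by cases b <;> simp [vY])

/-- `0 ≤ vX ≤ vShift`. [cite: EntingJensen2009, §7.4.2, Fig. 7.10] -/
theorem vX_bounds (b : Bool) (i : ℕ) : 0 ≤ vX b i ∧ vX b i ≤ vShift b := by
  cases b <;> simp only [vX, vShift] <;> split_ifs <;> omega

/-- `1 ≤ vX` from time `1` on. [cite: EntingJensen2009, §7.4.2, Fig. 7.10] -/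
theorem one_le_vX (b : Bool) {i : ℕ} (hi : 1 ≤ i) : 1 ≤ vX b i := by
  cases b <;> simp only [vX] <;> split_ifs <;> omega

/-- The unit ends `vShift` columns to the right. [cite: EntingJensen2009, §7.4.2, Fig. 7.10] -/
theorem vX_vLen (b : Bool) : vX b (vLen b) = vShift b := by cases b <;> simp [vX, vLen, vShift]

/-- The unit ends on its starting row. [cite: EntingJensen2009, §7.4.2, Fig. 7.10] -/
theorem vY_vLen (b : Bool) : vY b (vLen b) = 0 := by cases b <;> simp [vY, vLen]

/-- `vShift` is even. [cite: EntingJensen2009, §7.4.2, Fig. 7.10] -/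
theorem vShift_mod_two (b : Bool) : vShift b % 2 = 0 := by cases b <;> simp [vShift]

/-- `2 ≤ vShift`. [cite: EntingJensen2009, §7.4.2, Fig. 7.10] -/
theorem two_le_vShift (b : Bool) : 2 ≤ vShift b := by cases b <;> simp [vShift]

/-- At time `2` the abscissa offset tells the unit apart: `2` for plain, `1` for excursion. [cite: EntingJensen2009, §7.4.2, Fig. 7.10] -/
theorem vX_two (b : Bool) : vX b 2 = if b then 1 else 2 := by cases b <;> simp [vX]

/-- `2 ≤ vLen`. [cite: EntingJensen2009, §7.4.2, Fig. 7.10] -/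
theorem two_le_vLen (b : Bool) : 2 ≤ vLen b := by cases b <;> simp [vLen]

/-- The unit is frozen after its length. [cite: MadrasSlade1993, §1.1] -/
theorem vUnit_of_le (b : Bool) {i : ℕ} (hi : vLen b ≤ i) : vUnit b i = vUnit b (vLen b) := by
  refine site_ext₂ ?_ ?_
  · rw [vUnit_apply_zero, vUnit_apply_zero, vX_vLen]
    cases b
    · simp only [vLen] at hi
      simp only [vX, vShift, if_neg (show i ≠ 0 by omega), if_neg (show i ≠ 1 by omega)]
    · simp only [vLen] at hi
      simp only [vX, vShift, if_neg (show i ≠ 0 by omega), if_neg (show ¬ i ≤ 2 by omega), if_neg (show i ≠ 3 by omega),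
        if_neg (show ¬ i ≤ 5 by omega)]
  · rw [vUnit_apply_one, vUnit_apply_one, vY_vLen]
    cases b
    · simp only [vY]
    · simp only [vLen] at hi
      simp only [vY, if_neg (show ¬ i ≤ 1 by omega), if_neg (show ¬ i ≤ 4 by omega)]

/-- The rows visited by a unit are `0` or `1`. [cite: EntingJensen2009, §7.4.2, Fig. 7.10] -/
theorem vY_row (b : Bool) (i : ℕ) : 0 ≤ vY b i ∧ vY b i ≤ 1 := by
  cases b
  · simp [vY]
  · simp only [vY]; split_ifs <;> norm_num

/-- **The unit placed at a bottom wall vertex (odd abscissa, row `0`) steps along brick-wall bonds**: the excursion's vertical bonds are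
at the even columns `a+1` (up) and `a+3` (down). [cite: EntingJensen2009, §7.4.2, Fig. 7.10 (vertical bonds {(x,y),(x,y+1)} with x+y even)] -/
theorem vUnit_adj {a : Site 2} (ha0 : a 0 % 2 = 1) (ha1 : a 1 = 0) (b : Bool) {i : ℕ}
    (hi : i < vLen b) : brickWallGraph.Adj (a + vUnit b i) (a + vUnit b (i + 1)) := by
  rw [brickWallGraph_adj_coord]
  simp only [Pi.add_apply, vUnit_apply_zero, vUnit_apply_one]
  cases b <;> simp only [vLen] at hi
  · interval_cases i
    · simp [vX, vY]
    · simp [vX, vY]; omega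
  · interval_cases i
    · simp [vX, vY]
    · simp [vX, vY]; omega
    · simp [vX, vY]; omega
    · simp [vX, vY]; omega
    · simp [vX, vY]; omega
    · simp [vX, vY]; omega

/-- The unit is injective on `{0,…,vLen b}`. [cite: MadrasSlade1993, §1.1] -/
theorem vUnit_injOn (b : Bool) : Set.InjOn (vUnit b) {i | i ≤ vLen b} := by
  intro i hi j hj h
  simp only [Set.mem_setOf_eq] at hi hj
  have h0 := congrFun h 0
  have h1 := congrFun h 1
  simp only [vUnit_apply_zero, vUnit_apply_one] at h0 h1
  cases b <;> simp only [vLen] at hi hj <;> simp only [vX, vY] at h0 h1 <;> split_ifs at h0 h1 <;> omega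

/-- The unit is a self-avoiding walk of `ℤ²` of length `vLen b` (adjacency read off the copy placed at `(1,0)`). [cite: MadrasSlade1993, §1.1] -/
theorem vUnit_mem_saws (b : Bool) : vUnit b ∈ Zd.saws 2 (vLen b) := by
  rw [Zd.mem_saws]
  refine ⟨vUnit_zero b, fun i hi => vUnit_of_le b hi, fun i hi => ?_, vUnit_injOn b⟩
  set a : Site 2 := ![1, 0] with ha
  have h := zd_adj_of_adj (vUnit_adj (a := a) (by simp [ha]) (by simp [ha]) b hi)
  rwa [add_comm a, add_comm a, Zd.zdGraph_adj_add_right] at h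

/-- Bottom-wall vertices of a placed unit at positive times: exactly one (its endpoint). [cite: BeatonBousquetMelouDeGierDuminilCopinGuttmann2014, §3.2 (arXiv v5 p. 10: bc(ω))] -/
theorem sum_vUnit_bot {a : Site 2} (ha0 : a 0 % 2 = 1) (ha1 : a 1 = 0) (b : Bool) :
    ∑ j ∈ range (vLen b), (if (a + vUnit b (j + 1)) 1 = 0 ∧ (a + vUnit b (j + 1)) 0 % 2 = 1 then 1 else 0) = 1 := by
  have h1 : (a 0 + 1) % 2 ≠ 1 := by omega
  have h2 : (a 0 + 2) % 2 = 1 := by omega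
  have h3 : (a 0 + 3) % 2 ≠ 1 := by omega
  have h4 : (a 0 + 4) % 2 = 1 := by omega
  cases b <;> simp only [vLen, Finset.sum_range_succ, Finset.sum_range_zero, Pi.add_apply, vUnit_apply_zero, vUnit_apply_one, vX, vY,
    ha1] <;> simp [h1, h2, h3, h4]

/-! ### §2 Excursion walks: words in the two units -/

/-- The excursion indicator of unit `i`. [cite: BeatonBousquetMelouDeGierDuminilCopinGuttmann2014, §3.2 (arXiv v5 p. 10)] -/
def ew (s : Finset ℕ) (i : ℕ) : Bool := decide (i ∈ s)

/-- **The excursion walk** of the excursion set `s` with `n` units, from unit index `i₀` (from the origin, frozen at the end).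
[cite: MadrasSlade1993, §1.2 (concatenation); EntingJensen2009, §7.4.2, Fig. 7.10] -/
def exWalk (s : Finset ℕ) : ℕ → ℕ → (ℕ → Site 2)
  | 0, _ => fun _ => 0
  | n + 1, i₀ => Zd.concatWalk (vLen (ew s i₀)) (vUnit (ew s i₀)) (exWalk s n (i₀ + 1))

/-- The length of the excursion walk. [cite: MadrasSlade1993, §1.2] -/
def exLen (s : Finset ℕ) (i₀ n : ℕ) : ℕ := ∑ i ∈ range n, vLen (ew s (i₀ + i))

/-- Unfolding the length. [cite: MadrasSlade1993, §1.2] -/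
theorem exLen_succ (s : Finset ℕ) (i₀ n : ℕ) : exLen s i₀ (n + 1) = vLen (ew s i₀) + exLen s (i₀ + 1) n := by
  rw [exLen, exLen, Finset.sum_range_succ', add_comm, Nat.add_zero]
  congr 1
  exact Finset.sum_congr rfl fun i _ => by rw [show i₀ + (i + 1) = i₀ + 1 + i by omega]

/-- `exLen s i₀ 0 = 0`. [cite: MadrasSlade1993, §1.2] -/
@[simp] theorem exLen_zero (s : Finset ℕ) (i₀ : ℕ) : exLen s i₀ 0 = 0 := by simp [exLen]

/-- **Length = `2n + 4·#s`** for an excursion set `s ⊆ {0,…,n−1}`. [cite: MadrasSlade1993, §8.2] -/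
theorem exLen_eq (n : ℕ) {s : Finset ℕ} (hs : s ⊆ range n) : exLen s 0 n = 2 * n + 4 * #s := by
  have e : ∀ i, vLen (ew s (0 + i)) = 2 + (if i ∈ s then 4 else 0) := by
    intro i
    rw [Nat.zero_add, ew]
    by_cases h : i ∈ s <;> simp [h, vLen]
  rw [exLen, Finset.sum_congr rfl fun i _ => e i, Finset.sum_add_distrib, Finset.sum_const, Finset.card_range,
    smul_eq_mul, mul_comm, ← Finset.sum_filter, Finset.filter_mem_eq_inter, Finset.inter_eq_right.2 hs, Finset.sum_const,
    smul_eq_mul]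
  ring

/-- Unfolding the walk. [cite: MadrasSlade1993, §1.2] -/
theorem exWalk_succ (s : Finset ℕ) (n : ℕ) (i₀ : ℕ) :
    exWalk s (n + 1) i₀ = Zd.concatWalk (vLen (ew s i₀)) (vUnit (ew s i₀)) (exWalk s n (i₀ + 1)) := rfl

/-- The excursion walk starts at the origin. [cite: MadrasSlade1993, §1.1] -/
theorem exWalk_zero (s : Finset ℕ) (n : ℕ) (i₀ : ℕ) : exWalk s n i₀ 0 = 0 := by
  cases n with
  | zero => rfl
  | succ n => rw [exWalk_succ, concat_of_le (Nat.zero_le _), vUnit_zero]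

/-- The abscissa is non-negative. [cite: MadrasSlade1993, §8.2] -/
theorem exWalk_apply_zero_nonneg (s : Finset ℕ) (n : ℕ) (i₀ i : ℕ) : 0 ≤ exWalk s n i₀ i 0 := by
  induction n generalizing i₀ i with
  | zero => simp [exWalk]
  | succ n ih =>
    rw [exWalk_succ]
    by_cases h : i ≤ vLen (ew s i₀)
    · rw [concat_of_le h, vUnit_apply_zero]; exact (vX_bounds _ _).1
    · rw [concat_of_lt (Nat.not_le.1 h), Pi.add_apply, vUnit_apply_zero]
      exact add_nonneg (vX_bounds _ _).1 (ih _ _)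

/-- The abscissa is `≥ 1` at every positive time up to the length. [cite: MadrasSlade1993, §8.2] -/
theorem one_le_exWalk_apply_zero (s : Finset ℕ) (n : ℕ) (i₀ : ℕ) {i : ℕ} (hi : 1 ≤ i) (hin : i ≤ exLen s i₀ n) :
    1 ≤ exWalk s n i₀ i 0 := by
  cases n with
  | zero => simp at hin; omega
  | succ n =>
    rw [exWalk_succ]
    by_cases h : i ≤ vLen (ew s i₀)
    · rw [concat_of_le h, vUnit_apply_zero]; exact one_le_vX _ hi
    · rw [concat_of_lt (Nat.not_le.1 h), Pi.add_apply, vUnit_apply_zero, vX_vLen]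
      have := exWalk_apply_zero_nonneg s n (i₀ + 1) (i - vLen (ew s i₀))
      linarith [two_le_vShift (ew s i₀)]

/-- **Excursion walks are self-avoiding walks of `ℤ²`** (the pieces are separated by their abscissae). [cite: MadrasSlade1993, §1.2 (concatenation of walks)] -/
theorem exWalk_mem_saws (s : Finset ℕ) (n : ℕ) (i₀ : ℕ) : exWalk s n i₀ ∈ Zd.saws 2 (exLen s i₀ n) := by
  induction n generalizing i₀ with
  | zero =>
    rw [exLen_zero, Zd.mem_saws]
    exact ⟨rfl, fun _ _ => rfl, fun i hi => absurd hi (Nat.not_lt_zero _), fun i hi j hj _ => by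
      simp only [Set.mem_setOf_eq, Nat.le_zero] at hi hj; rw [hi, hj]⟩
  | succ n ih =>
    rw [exLen_succ, exWalk_succ]
    refine Zd.concatWalk_mem_saws (vUnit_mem_saws _) (ih (i₀ + 1)) fun i hi j hj1 hj2 heq => ?_
    have h0 := congrFun heq 0
    simp only [Pi.add_apply, vUnit_apply_zero, vX_vLen] at h0
    have h1 := (vX_bounds (ew s i₀) i).2
    have h2 := one_le_exWalk_apply_zero s n (i₀ + 1) hj1 hj2
    omega

/-- The rows of an excursion walk are `0` or `1`. [cite: MadrasSlade1993, §8.2, eq. (8.2.1)] -/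
theorem exWalk_row (s : Finset ℕ) (n : ℕ) (i₀ i : ℕ) : 0 ≤ exWalk s n i₀ i 1 ∧ exWalk s n i₀ i 1 ≤ 1 := by
  induction n generalizing i₀ i with
  | zero => simp [exWalk]
  | succ n ih =>
    rw [exWalk_succ]
    by_cases h : i ≤ vLen (ew s i₀)
    · rw [concat_of_le h, vUnit_apply_one]; exact vY_row _ _
    · rw [concat_of_lt (Nat.not_le.1 h), Pi.add_apply, vUnit_apply_one, vY_vLen, zero_add]
      exact ih _ _

/-- Placing a concatenation = concatenating the placed first piece with the same second piece. [cite: MadrasSlade1993, §1.2] -/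
private theorem add_concatWalk' (a : Site 2) (m : ℕ) (ω υ : ℕ → Site 2) :
    (fun i => a + Zd.concatWalk m ω υ i) = Zd.concatWalk m (fun i => a + ω i) υ := by
  funext i
  by_cases h : i ≤ m
  · rw [concat_of_le h, concat_of_le h]
  · rw [concat_of_lt (Nat.not_le.1 h), concat_of_lt (Nat.not_le.1 h), add_assoc]

/-- **The placed excursion walk steps along brick-wall bonds** (start = a bottom wall vertex: abscissa odd, row `0`).
[cite: EntingJensen2009, §7.4.2, Fig. 7.10; MadrasSlade1993, §8.2] -/
theorem isBW_exWalk (s : Finset ℕ) (n : ℕ) (i₀ : ℕ) {a : Site 2} (ha0 : a 0 % 2 = 1) (ha1 : a 1 = 0) :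
    IsBW (exLen s i₀ n) (fun i => a + exWalk s n i₀ i) := by
  induction n generalizing i₀ a with
  | zero => intro i hi; simp at hi
  | succ n ih =>
    rw [exLen_succ, exWalk_succ, add_concatWalk']
    refine isBW_concatWalk (fun i hi => vUnit_adj ha0 ha1 _ hi) (exWalk_zero _ _ _) fun j hj => ?_
    have hb0 : (a + vUnit (ew s i₀) (vLen (ew s i₀))) 0 % 2 = 1 := by
      rw [Pi.add_apply, vUnit_apply_zero, vX_vLen]; have := vShift_mod_two (ew s i₀); omega
    have hb1 : (a + vUnit (ew s i₀) (vLen (ew s i₀))) 1 = 0 := by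
      rw [Pi.add_apply, vUnit_apply_one, vY_vLen, ha1, add_zero]
    have h := ih (i₀ + 1) hb0 hb1 j hj
    simpa only [add_assoc] using h

/-! ### §3 The excursion walks as members of `S_N(S_1)`; their weight -/

/-- The bottom wall vertex `(1,0)` of `S_1`. [cite: MadrasSlade1993, §8.2, eq. (8.2.1)] -/
def exStart : Site 2 := ![1, 0]

/-- Coordinates of the starting site. [cite: MadrasSlade1993, §8.2, eq. (8.2.1)] -/
@[simp] theorem exStart_apply_zero : exStart 0 = 1 := rfl

/-- Coordinates of the starting site. [cite: MadrasSlade1993, §8.2, eq. (8.2.1)] -/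
@[simp] theorem exStart_apply_one : exStart 1 = 0 := rfl

/-- The translation class of the excursion walk of `s` with `n` units. [cite: MadrasSlade1993, §8.2] -/
def exPair (n : ℕ) (s : Finset ℕ) : Site 2 × (ℕ → Site 2) := (exStart, exWalk s n 0)

/-- **Excursion walks are walks of `S_N(S_1)`, `N = exLen s 0 n`** (hence of every `S_T`, `T ≥ 1`). [cite: MadrasSlade1993, §8.2; BeatonBousquetMelouDeGierDuminilCopinGuttmann2014, §3.2 (arXiv v5 p. 10)] -/
theorem exPair_mem_stripPairs (n : ℕ) (s : Finset ℕ) : exPair n s ∈ stripPairs 1 (exLen s 0 n) := by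
  rw [mem_stripPairs, exPair]
  refine ⟨mem_stripStarts.2 ⟨⟨by simp, by simp⟩, by simp, by simp⟩,
    exWalk_mem_saws s n 0, isBW_exWalk s n 0 (by simp) (by simp), fun m _ => ?_⟩
  have h := exWalk_row s n 0 m
  exact ⟨by simp [h.1], by simpa using h.2⟩

/-- Bottom wall vertices at the positive times `1,…,N` of a placed walk. [cite: BeatonBousquetMelouDeGierDuminilCopinGuttmann2014, §3.2 (arXiv v5 p. 10: bc(ω))] -/
def botPos (a : Site 2) (υ : ℕ → Site 2) (N : ℕ) : ℕ :=
  ∑ j ∈ range N, if (a + υ (j + 1)) 1 = 0 ∧ (a + υ (j + 1)) 0 % 2 = 1 then 1 else 0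

/-- **Each unit adds exactly one bottom wall vertex**: `botPos = n`. [cite: BeatonBousquetMelouDeGierDuminilCopinGuttmann2014, §3.2 (arXiv v5 p. 10)] -/
theorem botPos_exWalk (s : Finset ℕ) (n : ℕ) (i₀ : ℕ) {a : Site 2} (ha0 : a 0 % 2 = 1) (ha1 : a 1 = 0) :
    botPos a (exWalk s n i₀) (exLen s i₀ n) = n := by
  induction n generalizing i₀ a with
  | zero => simp [botPos]
  | succ n ih =>
    rw [botPos, exLen_succ, Finset.sum_range_add, exWalk_succ]
    have h1 : ∑ j ∈ range (vLen (ew s i₀)), (if (a + Zd.concatWalk (vLen (ew s i₀)) (vUnit (ew s i₀))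
        (exWalk s n (i₀ + 1)) (j + 1)) 1 = 0 ∧ (a + Zd.concatWalk (vLen (ew s i₀)) (vUnit (ew s i₀))
        (exWalk s n (i₀ + 1)) (j + 1)) 0 % 2 = 1 then 1 else 0) = 1 := by
      refine Eq.trans (Finset.sum_congr rfl fun j hj => ?_) (sum_vUnit_bot ha0 ha1 (ew s i₀))
      rw [concat_of_le (Nat.succ_le_of_lt (Finset.mem_range.1 hj))]
    have hb0 : (a + vUnit (ew s i₀) (vLen (ew s i₀))) 0 % 2 = 1 := by
      rw [Pi.add_apply, vUnit_apply_zero, vX_vLen]; have := vShift_mod_two (ew s i₀); omega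
    have hb1 : (a + vUnit (ew s i₀) (vLen (ew s i₀))) 1 = 0 := by
      rw [Pi.add_apply, vUnit_apply_one, vY_vLen, ha1, add_zero]
    have h2 := ih (i₀ + 1) hb0 hb1
    rw [botPos] at h2
    rw [h1, add_comm (1 : ℕ)]
    congr 1
    refine Eq.trans (Finset.sum_congr rfl fun j _ => ?_) h2
    rw [show vLen (ew s i₀) + j + 1 = vLen (ew s i₀) + (j + 1) by omega, concat_add (exWalk_zero _ _ _), add_assoc]

/-- `bottomVisits₀ = [start is a bottom wall vertex] + botPos`. [cite: BeatonBousquetMelouDeGierDuminilCopinGuttmann2014, §3.2 (arXiv v5 p. 10)] -/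
theorem bottomVisits₀_eq_botPos (a : Site 2) (υ : ℕ → Site 2) (N : ℕ) :
    bottomVisits₀ a υ N = (if (a + υ 0) 1 = 0 ∧ (a + υ 0) 0 % 2 = 1 then 1 else 0) + botPos a υ N := by
  unfold bottomVisits₀ botPos
  rw [Finset.sum_range_succ', add_comm]

/-- **The excursion walk of `n` units has exactly `n + 1` bottom wall vertices.** [cite: BeatonBousquetMelouDeGierDuminilCopinGuttmann2014, §3.2 (arXiv v5 p. 10: y^{bc(ω)})] -/
theorem bottomVisits₀_exWalk (n : ℕ) (s : Finset ℕ) :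
    bottomVisits₀ exStart (exWalk s n 0) (exLen s 0 n) = n + 1 := by
  rw [bottomVisits₀_eq_botPos, botPos_exWalk s n 0 (by simp) (by simp), exWalk_zero]
  simp [add_comm]

/-- The tail of an excursion walk is read off the walk: `W'(i) = W(i + m) − U(m)`. [cite: MadrasSlade1993, §1.2] -/
private theorem exWalk_tail (s : Finset ℕ) (n : ℕ) (i₀ i : ℕ) :
    exWalk s n (i₀ + 1) i = exWalk s (n + 1) i₀ (vLen (ew s i₀) + i) - vUnit (ew s i₀) (vLen (ew s i₀)) := by
  rw [exWalk_succ, concat_add (exWalk_zero _ _ _), add_sub_cancel_left]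

/-- **Distinct excursion sets give distinct walks** (unit `i₀` is read off the abscissa at time `2`, then induct on the tail).
[cite: MadrasSlade1993, §8.2] -/
theorem exWalk_decode (n : ℕ) {s s' : Finset ℕ} {i₀ : ℕ} (h : exWalk s n i₀ = exWalk s' n i₀) :
    ∀ i, i₀ ≤ i → i < i₀ + n → (i ∈ s ↔ i ∈ s') := by
  induction n generalizing i₀ with
  | zero => intro i h1 h2; omega
  | succ n ih =>
    have hb : ew s i₀ = ew s' i₀ := by
      have h2 := congrFun (congrFun h 2) 0
      rw [exWalk_succ, exWalk_succ, concat_of_le (two_le_vLen _), concat_of_le (two_le_vLen _), vUnit_apply_zero,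
        vUnit_apply_zero, vX_two, vX_two] at h2
      revert h2
      cases ew s i₀ <;> cases ew s' i₀ <;> simp
    have htail : exWalk s n (i₀ + 1) = exWalk s' n (i₀ + 1) := by
      funext i
      have t1 := exWalk_tail s n i₀ i
      have t2 := exWalk_tail s' n i₀ i
      rw [← hb] at t2
      rw [t1, t2, h]
    intro i h1 h2
    rcases Nat.eq_or_lt_of_le h1 with h3 | h3
    · subst h3
      have : (ew s i₀ = true) ↔ (ew s' i₀ = true) := by rw [hb]
      simpa [ew] using this
    · exact ih htail i (by omega) (by omega)

/-- **`exPair n` is injective on the excursion sets `s ⊆ {0,…,n−1}`.** [cite: MadrasSlade1993, §8.2] -/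
theorem exPair_injOn (n k : ℕ) : Set.InjOn (exPair n) ↑((range n).powersetCard k) := by
  intro s hs s' hs' h
  have hs1 := (Finset.mem_powersetCard.1 (Finset.mem_coe.1 hs)).1
  have hs1' := (Finset.mem_powersetCard.1 (Finset.mem_coe.1 hs')).1
  have hw : exWalk s n 0 = exWalk s' n 0 := congrArg Prod.snd h
  ext i
  by_cases hi : i < n
  · exact exWalk_decode n hw i (Nat.zero_le _) (by omega)
  · constructor
    · intro h'; exact absurd (Finset.mem_range.1 (hs1 h')) hi
    · intro h'; exact absurd (Finset.mem_range.1 (hs1' h')) hi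

/-! ### §4 The finite lower bound and the rate -/

/-- **`C(n,k)·y^{n+1} ≤ C_{1,2n+4k}(y,1)`** (`y ≥ 0`): the excursion walks with `k` excursions among `n` units are `C(n,k)` distinct walks of
`S_{2n+4k}(S_1)`, each with `n + 1` bottom wall vertices. [cite: BeatonBousquetMelouDeGierDuminilCopinGuttmann2014, §3.2 (arXiv v5 p. 10: C_{T,k}(y,z)); MadrasSlade1993, §8.2] -/
theorem choose_mul_pow_le_stripZ₂_one_one (hy : 0 ≤ y) (n k : ℕ) :
    ((n.choose k : ℕ) : ℝ) * y ^ (n + 1) ≤ stripZ₂ 1 (2 * n + 4 * k) y 1 := by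
  classical
  set S := (range n).powersetCard k with hS
  have hmem : ∀ s ∈ S, exPair n s ∈ stripPairs 1 (2 * n + 4 * k) := by
    intro s hs
    obtain ⟨hsub, hcard⟩ := Finset.mem_powersetCard.1 hs
    have h := exPair_mem_stripPairs n s
    rwa [exLen_eq n hsub, hcard] at h
  have hw : ∀ s ∈ S, y ^ bottomVisits₀ (exPair n s).1 (exPair n s).2 (2 * n + 4 * k) *
      (1 : ℝ) ^ topVisits₀ 1 (exPair n s).1 (exPair n s).2 (2 * n + 4 * k) = y ^ (n + 1) := by
    intro s hs
    obtain ⟨hsub, hcard⟩ := Finset.mem_powersetCard.1 hs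
    rw [one_pow, mul_one, exPair]
    simp only
    rw [← hcard, ← exLen_eq n hsub, bottomVisits₀_exWalk]
  calc ((n.choose k : ℕ) : ℝ) * y ^ (n + 1) = ∑ s ∈ S, y ^ (n + 1) := by
        rw [Finset.sum_const, hS, Finset.card_powersetCard, Finset.card_range, nsmul_eq_mul]
    _ = ∑ s ∈ S, y ^ bottomVisits₀ (exPair n s).1 (exPair n s).2 (2 * n + 4 * k) *
          (1 : ℝ) ^ topVisits₀ 1 (exPair n s).1 (exPair n s).2 (2 * n + 4 * k) := Finset.sum_congr rfl fun s hs => (hw s hs).symm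
    _ = ∑ p ∈ S.image (exPair n), y ^ bottomVisits₀ p.1 p.2 (2 * n + 4 * k) * (1 : ℝ) ^ topVisits₀ 1 p.1 p.2 (2 * n + 4 * k) := by
        rw [Finset.sum_image fun s hs s' hs' h => exPair_injOn n k hs hs' h]
    _ ≤ stripZ₂ 1 (2 * n + 4 * k) y 1 := by
        rw [stripZ₂]
        refine Finset.sum_le_sum_of_subset_of_nonneg (fun p hp => ?_) fun p _ _ => by positivity
        obtain ⟨s, hs, rfl⟩ := Finset.mem_image.1 hp
        exact hmem s hs

/-- The finite bound along `N = j(2m+4)`: `(m·y^m)^j ≤ C_{1, j(2m+4)}(y,1)` (`y ≥ 1`). [cite: BeatonBousquetMelouDeGierDuminilCopinGuttmann2014, §3.2 (arXiv v5 p. 10); MadrasSlade1993, §8.2] -/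
theorem mul_pow_pow_le_stripZ₂_one_one (hy : 1 ≤ y) (m j : ℕ) :
    ((m : ℝ) * y ^ (m : ℕ)) ^ j ≤ stripZ₂ 1 (j * (2 * m + 4)) y 1 := by
  have hy0 : 0 ≤ y := by linarith
  have h := choose_mul_pow_le_stripZ₂_one_one hy0 (j * m) j
  rw [show 2 * (j * m) + 4 * j = j * (2 * m + 4) by ring] at h
  have hc : ((m : ℝ) ^ j) ≤ ((j * m).choose j : ℕ) := by
    rw [mul_comm j m]; exact_mod_cast Zd.pow_le_choose_mul m j
  calc ((m : ℝ) * y ^ (m : ℕ)) ^ j = (m : ℝ) ^ j * y ^ (j * m) := by rw [mul_pow, ← pow_mul, mul_comm m j]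
    _ ≤ ((j * m).choose j : ℕ) * y ^ (j * m) := mul_le_mul_of_nonneg_right hc (by positivity)
    _ ≤ ((j * m).choose j : ℕ) * y ^ (j * m + 1) :=
        mul_le_mul_of_nonneg_left (pow_le_pow_right₀ hy (Nat.le_succ _)) (by positivity)
    _ ≤ stripZ₂ 1 (j * (2 * m + 4)) y 1 := h

/-- **`(m·y^m)^{1/(2m+4)} ≤ μ_1(y,1)`** for every `m`, `y ≥ 1`. [cite: BeatonBousquetMelouDeGierDuminilCopinGuttmann2014, Proposition 6 (arXiv v5 p. 10: μ_T(y,z) = lim C_{T,n}(y,z)^{1/n}); MadrasSlade1993, §8.2, (8.2.2)–(8.2.3)] -/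
theorem rpow_le_stripMuY₂_one_one (hy : 1 ≤ y) (m : ℕ) :
    ((m : ℝ) * y ^ (m : ℕ)) ^ (1 / (2 * (m : ℝ) + 4)) ≤ stripMuY₂ 1 y 1 := by
  have hy0 : 0 < y := by linarith
  have hL := tendsto_stripZ₂_rpow 1 hy0 one_pos
  have hφt : Tendsto (fun j : ℕ => (j + 1) * (2 * m + 4)) atTop atTop :=
    tendsto_atTop_mono (fun j => by show j ≤ (j + 1) * (2 * m + 4); nlinarith) tendsto_id
  have hL' := hL.comp hφt
  refine ge_of_tendsto' hL' fun j => ?_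
  simp only [Function.comp]
  have hc0 : (0 : ℝ) ≤ (m : ℝ) * y ^ (m : ℕ) := by positivity
  have hN : ((((j + 1) * (2 * m + 4) : ℕ) : ℝ)) = ((j : ℝ) + 1) * (2 * (m : ℝ) + 4) := by push_cast; ring
  have hpos : (0 : ℝ) < 2 * (m : ℝ) + 4 := by positivity
  have e : ((m : ℝ) * y ^ (m : ℕ)) ^ (1 / (2 * (m : ℝ) + 4)) =
      ((((m : ℝ) * y ^ (m : ℕ)) ^ (j + 1) : ℝ)) ^ (1 / ((((j + 1) * (2 * m + 4) : ℕ) : ℝ))) := by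
    rw [hN, ← Real.rpow_natCast ((m : ℝ) * y ^ (m : ℕ)) (j + 1), ← Real.rpow_mul hc0]
    congr 1
    push_cast
    field_simp
  rw [e]
  exact Real.rpow_le_rpow (by positivity) (mul_pow_pow_le_stripZ₂_one_one hy m (j + 1)) (by positivity)

/-- **`m·y^m ≤ μ_1(y,1)^{2m+4}`** for every `m`, `y ≥ 1`. [cite: BeatonBousquetMelouDeGierDuminilCopinGuttmann2014, Proposition 6 (arXiv v5 p. 10)] -/
theorem mul_pow_le_stripMuY₂_one_one_pow (hy : 1 ≤ y) (m : ℕ) :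
    (m : ℝ) * y ^ (m : ℕ) ≤ stripMuY₂ 1 y 1 ^ (2 * m + 4) := by
  have hy0 : 0 < y := by linarith
  have hμ := (stripMuY₂_pos 1 hy0 one_pos).le
  have hc0 : (0 : ℝ) ≤ (m : ℝ) * y ^ (m : ℕ) := by positivity
  have h := rpow_le_stripMuY₂_one_one hy m
  have hpos : (0 : ℝ) < 2 * (m : ℝ) + 4 := by positivity
  have hN : (((2 * m + 4 : ℕ) : ℝ)) = 2 * (m : ℝ) + 4 := by push_cast; ring
  have e : (m : ℝ) * y ^ (m : ℕ) = (((m : ℝ) * y ^ (m : ℕ)) ^ (1 / (2 * (m : ℝ) + 4))) ^ (2 * m + 4) := by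
    rw [← Real.rpow_natCast (((m : ℝ) * y ^ (m : ℕ)) ^ (1 / (2 * (m : ℝ) + 4))) (2 * m + 4), ← Real.rpow_mul hc0, hN,
      one_div_mul_cancel hpos.ne', Real.rpow_one]
  rw [e]
  exact pow_le_pow_left₀ (by positivity) h _

/-! ### §5 The lower window `y + 3/(10y) ≤ μ_T(y,z)²` (`T ≥ 1`, `z ≥ 1`, `y ≥ 4`) -/

/-- `(1 + x)^n ≤ exp(n·x)` for `x ≥ 0`. [folklore] -/
private theorem one_add_pow_le_exp_mul₂ {x : ℝ} (hx : 0 ≤ x) (n : ℕ) : (1 + x) ^ n ≤ Real.exp (n * x) := by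
  calc (1 + x) ^ n ≤ (Real.exp x) ^ n := pow_le_pow_left₀ (by linarith) (by linarith [Real.add_one_le_exp x]) n
    _ = Real.exp (n * x) := (Real.exp_nat_mul x n).symm

/-- ★ **`y + 3/(10y) ≤ μ_1(y,1)²` for every `y ≥ 4`** (excursion walks with `m = ⌊3y²⌋ + 1`: `(y + 0.3/y)^{m+2} < m·y^m ≤ μ_1(y,1)^{2m+4}`).
[cite: BeatonBousquetMelouDeGierDuminilCopinGuttmann2014, §3.2 Propositions 6–7 (arXiv v5 pp. 10–11)] -/
theorem add_div_le_stripMuY₂_one_one_sq (hy : 4 ≤ y) : y + 3 / (10 * y) ≤ stripMuY₂ 1 y 1 ^ 2 := by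
  have hy0 : 0 < y := by linarith
  have hy1 : 1 ≤ y := by linarith
  set m : ℕ := ⌊3 * y ^ 2⌋₊ + 1 with hm
  have hm_gt : 3 * y ^ 2 < m := by rw [hm]; push_cast; exact Nat.lt_floor_add_one _
  have hm_le : (m : ℝ) ≤ 3 * y ^ 2 + 1 := by
    rw [hm]; push_cast; linarith [Nat.floor_le (by positivity : 0 ≤ 3 * y ^ 2)]
  set x : ℝ := 3 / (10 * y ^ 2) with hx
  have hx0 : 0 ≤ x := by rw [hx]; positivity
  have hw : y + 3 / (10 * y) = y * (1 + x) := by rw [hx]; field_simp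
  have hnx : ((m + 2 : ℕ) : ℝ) * x ≤ 1 := by
    push_cast
    rw [hx, mul_div_assoc', div_le_one (by positivity)]
    nlinarith
  have hexp : (1 + x) ^ (m + 2) < 3 := by
    calc (1 + x) ^ (m + 2) ≤ Real.exp (((m + 2 : ℕ) : ℝ) * x) := one_add_pow_le_exp_mul₂ hx0 _
      _ ≤ Real.exp 1 := Real.exp_le_exp.2 hnx
      _ < 3 := by have := Real.exp_one_lt_d9; norm_num at this ⊢; linarith
  have hμ := (stripMuY₂_pos 1 hy0 one_pos).le
  have hB := mul_pow_le_stripMuY₂_one_one_pow hy1 m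
  have key : (y + 3 / (10 * y)) ^ (m + 2) < (stripMuY₂ 1 y 1 ^ 2) ^ (m + 2) := by
    calc (y + 3 / (10 * y)) ^ (m + 2) = y ^ (m + 2) * (1 + x) ^ (m + 2) := by rw [hw, mul_pow]
      _ < y ^ (m + 2) * 3 := mul_lt_mul_of_pos_left hexp (by positivity)
      _ = 3 * y ^ 2 * y ^ m := by ring
      _ < (m : ℝ) * y ^ m := mul_lt_mul_of_pos_right hm_gt (by positivity)
      _ ≤ stripMuY₂ 1 y 1 ^ (2 * m + 4) := hB
      _ = (stripMuY₂ 1 y 1 ^ 2) ^ (m + 2) := by rw [← pow_mul]; ring_nf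
  exact (lt_of_pow_lt_pow_left₀ _ (by positivity) key).le

/-- ★★ **THE LOWER WINDOW FOR EVERY WIDTH AND EVERY SECOND FUGACITY: `y + 3/(10y) ≤ μ_T(y,z)²` for all `T ≥ 1`, `z ≥ 1`, `y ≥ 4`**
(monotonicity of `μ_T(y,1)` in `T` — BBdGDCG14 Prop. 7 — and of `μ_T(y,z)` in `z` — Prop. 6). [cite: BeatonBousquetMelouDeGierDuminilCopinGuttmann2014, §3.2 Propositions 6–7 (arXiv v5 pp. 10–11)] -/
theorem add_div_le_stripMuY₂_sq {T : ℕ} (hT : 1 ≤ T) (hy : 4 ≤ y) {z : ℝ} (hz : 1 ≤ z) :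
    y + 3 / (10 * y) ≤ stripMuY₂ T y z ^ 2 := by
  have hy0 : 0 < y := by linarith
  have h1 := add_div_le_stripMuY₂_one_one_sq hy
  have h2 : stripMuY₂ 1 y 1 ≤ stripMuY₂ T y 1 := by
    rw [stripMuY₂_one_right, stripMuY₂_one_right]; exact stripMuY₀_mono hT hy0
  have h3 : stripMuY₂ T y 1 ≤ stripMuY₂ T y z := stripMuY₂_mono_right T hy0 one_pos hz
  have hμ := (stripMuY₂_pos 1 hy0 one_pos).le
  exact h1.trans (pow_le_pow_left₀ hμ (h2.trans h3) 2)

/-- **The one-wall strip rates (`stripMuY₀ T y = μ_T(y,1)`): `y + 3/(10y) ≤ μ_T(y,1)²` for all `T ≥ 1`, `y ≥ 4`.**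
[cite: BeatonBousquetMelouDeGierDuminilCopinGuttmann2014, §3.2 Proposition 7 (arXiv v5 p. 11: μ_T(1,y))] -/
theorem add_div_le_stripMuY₀_sq {T : ℕ} (hT : 1 ≤ T) (hy : 4 ≤ y) : y + 3 / (10 * y) ≤ stripMuY₀ T y ^ 2 := by
  rw [← stripMuY₂_one_right]; exact add_div_le_stripMuY₂_sq hT hy le_rfl

end Literature.Probability.RandomPlanarGeometry.SAW.HexBW
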